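import Literature.Barriers.CriticalPhenomena.LaceExpansionTorusIntegrals
import Literature.Barriers.CriticalPhenomena.LaceExpansionPcInputs
import Mathlib.MeasureTheory.Function.LpSeminorm.Basic
import HarnessLib

/-!
# `L^p` norms of `|k|^{-a}` on small balls: `‖ |k|^{-a} 1_{B_r} ‖_{L^p} = c r^{d/p - a}` (`ap < d`)

Barrier catalogue `Literature/Barriers/CriticalPhenomena/` (D-0021), infrastructure for the proof
of the named fact `SpreadOutIsing.LiuSlade2026_thm22` (Liu–Slade 2026, Theorem 2.2). The proof of
its Lemma 3.3 (§3.2) separates the small ball `B_L = {|k| < 1/L}` and repeatedly uses, in Hölder's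
inequality, the elementary norms "`|k|^{-1}1_{B_L}` has `L^q` norm bounded by `L^{1-d/q}` for
`q⁻¹ > 1/d`", "`‖ |k|^{-2}1_{B_L} ‖_p ≲ L^{2-d/p}` for `p⁻¹ > 2/d`", "the `L^q` norm of
`|k|^{-(2-σ+|γ|)}` on `B_L` is of order `L^{2-σ+|γ|-d/q}`" and "`‖ |k|^{-4}1_{B_L} ‖_p`,
`p⁻¹ > 4/d`". This file PROVES the general statement behind all four, on `ℝ^d = Fin d → ℝ` with
the sup norm `‖k‖` and Lebesgue measure (polar coordinates in the sup norm, the tree's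
`integral_fun_norm_pi`; the unit ball has volume `2^d`):

* `integral_ball_norm_rpow_neg` — `∫_{‖k‖ < r} ‖k‖^{-s} dk = d 2^d r^{d-s}/(d-s)` for `s < d`;
* `integrableOn_ball_norm_rpow_neg` — integrability of `‖k‖^{-s}` on balls for `s < d`;
* `eLpNorm_norm_rpow_neg_indicator_ball_le` — for `p > 0` and `ap < d`, the `L^p`
  norm over the cube `[-π,π]^d` of `‖k‖^{-a} 1_{‖k‖<r}` is at most
  `(d 2^d/(d - ap))^{1/p} r^{d/p - a}`; `eLpNorm_norm_rpow_neg_indicator_ball_inv_le` — the case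
  `r = 1/L`: `≤ (d 2^d/(d - ap))^{1/p} L^{a - d/p}`.

## References

* Y. Liu, G. Slade, *Gaussian deconvolution and the lace expansion for spread-out models*,
  Ann. Inst. H. Poincaré Probab. Statist. 62 (2026), arXiv:2310.07640: proof of Lemma 3.3
  (§3.2: the ball `B_L` and the norms of `|k|^{-1}1_{B_L}`, `|k|^{-2}1_{B_L}`, `|k|^{-(2-σ+|γ|)}1_{B_L}`,
  `|k|^{-4}1_{B_L}`) [LiuSlade2026].
-/

noncomputable section

namespace Literature.Barriers.CriticalPhenomena

open MeasureTheory Set Filter Real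
open scoped Topology BigOperators Real ENNReal

variable {d : ℕ}

/-! ## The integral of `‖k‖^{-s}` over a sup-norm ball -/

/-- The radial profile `1_{[0,r)}(y) y^{-s}` of `‖k‖^{-s} 1_{‖k‖ < r}`. [folklore] -/
theorem indicator_ball_norm_rpow_eq (r s : ℝ) (k : Fin d → ℝ) :
    (Metric.ball (0 : Fin d → ℝ) r).indicator (fun k => ‖k‖ ^ (-s)) k =
      (Iio r).indicator (fun y => y ^ (-s)) ‖k‖ := by
  by_cases hk : ‖k‖ < r
  · rw [indicator_of_mem (by simpa using hk), indicator_of_mem (mem_Iio.2 hk)]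
  · rw [indicator_of_notMem (by simpa using hk), indicator_of_notMem (fun h => hk (mem_Iio.1 h))]

/-- **`∫_{‖k‖ < r} ‖k‖^{-s} dk = d 2^d r^{d-s}/(d-s)`** for `s < d`, `r > 0`, `d ≥ 1` (sup norm on
`ℝ^d`; polar coordinates: `d 2^d ∫_0^r y^{d-1-s} dy`). [cite: LiuSlade2026, proof of Lemma 3.3 (§3.2: L^q norms of |k|^{-a}1_{B_L})] -/
theorem integral_ball_norm_rpow_neg (hd : 1 ≤ d) {s : ℝ} (hs : s < d) {r : ℝ} (hr : 0 < r) :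
    ∫ k in Metric.ball (0 : Fin d → ℝ) r, ‖k‖ ^ (-s) = d * 2 ^ d * (r ^ ((d : ℝ) - s) / (d - s)) := by
  have hds : 0 < (d : ℝ) - s := by linarith
  rw [← integral_indicator Metric.isOpen_ball.measurableSet]
  simp_rw [indicator_ball_norm_rpow_eq]
  rw [integral_fun_norm_pi hd]
  congr 1
  -- `∫_0^∞ y^{d-1} 1_{y<r} y^{-s} dy = ∫_0^r y^{d-1-s} dy = r^{d-s}/(d-s)`
  have h1 : ∫ y in Ioi (0 : ℝ), y ^ (d - 1) * (Iio r).indicator (fun y => y ^ (-s)) y =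
      ∫ y in Ioo (0 : ℝ) r, y ^ ((d : ℝ) - 1 - s) := by
    rw [show (∫ y in Ioo (0 : ℝ) r, y ^ ((d : ℝ) - 1 - s)) =
        ∫ y in Ioi (0 : ℝ), (Ioo (0 : ℝ) r).indicator (fun y => y ^ ((d : ℝ) - 1 - s)) y by
      rw [setIntegral_indicator measurableSet_Ioo, Set.inter_eq_right.2 Ioo_subset_Ioi_self]]
    refine setIntegral_congr_fun (measurableSet_Ioi : MeasurableSet (Ioi (0 : ℝ))) fun y hy => ?_
    have hy0 : 0 < y := hy
    by_cases hyr : y < r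
    · rw [indicator_of_mem (mem_Iio.2 hyr), indicator_of_mem (mem_Ioo.2 ⟨hy0, hyr⟩),
        ← Real.rpow_natCast, ← Real.rpow_add hy0, Nat.cast_sub hd]
      push_cast
      ring_nf
    · rw [indicator_of_notMem (fun h => hyr (mem_Iio.1 h)), indicator_of_notMem (fun h => hyr h.2), mul_zero]
  rw [h1, ← integral_Ioc_eq_integral_Ioo, ← intervalIntegral.integral_of_le hr.le,
    integral_rpow (Or.inl (by linarith))]
  have hexp : (d : ℝ) - 1 - s + 1 = d - s := by ring
  rw [hexp, Real.zero_rpow hds.ne', sub_zero]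

/-- `‖k‖^{-s}` is integrable on sup-norm balls of `ℝ^d` for `s < d` (`d ≥ 1`, `r > 0`). [folklore] -/
theorem integrableOn_ball_norm_rpow_neg (hd : 1 ≤ d) {s : ℝ} (hs : s < d) {r : ℝ} (hr : 0 < r) :
    IntegrableOn (fun k : Fin d → ℝ => ‖k‖ ^ (-s)) (Metric.ball 0 r) := by
  rw [← integrable_indicator_iff Metric.isOpen_ball.measurableSet]
  have hfun : (Metric.ball (0 : Fin d → ℝ) r).indicator (fun k => ‖k‖ ^ (-s)) =
      fun k => (Iio r).indicator (fun y => y ^ (-s)) ‖k‖ := funext (indicator_ball_norm_rpow_eq r s)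
  rw [hfun, integrable_fun_norm_pi hd]
  -- `y^{d-1} 1_{y<r} y^{-s}` is `y^{d-1-s}` on `(0,r)` and `0` beyond
  have ht : -1 < (d : ℝ) - 1 - s := by linarith
  have hf : IntegrableOn (fun y : ℝ => y ^ ((d : ℝ) - 1 - s)) (Ioo 0 r) := by
    have h := (intervalIntegral.intervalIntegrable_rpow' (a := 0) (b := r) ht).def'
    rw [uIoc_of_le hr.le] at h
    exact h.mono_set Ioo_subset_Ioc_self
  have h : IntegrableOn (fun y : ℝ => (Ioo (0 : ℝ) r).indicator (fun y => y ^ ((d : ℝ) - 1 - s)) y) (Ioi 0) :=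
    (hf.integrable_indicator measurableSet_Ioo).integrableOn
  refine h.congr_fun (fun y hy => ?_) (measurableSet_Ioi : MeasurableSet (Ioi (0 : ℝ)))
  have hy0 : 0 < y := hy
  show (Ioo (0 : ℝ) r).indicator (fun y => y ^ ((d : ℝ) - 1 - s)) y =
    y ^ (d - 1) * (Iio r).indicator (fun y => y ^ (-s)) y
  by_cases hyr : y < r
  · rw [indicator_of_mem (mem_Ioo.2 ⟨hy0, hyr⟩), indicator_of_mem (mem_Iio.2 hyr),
      ← Real.rpow_natCast, ← Real.rpow_add hy0, Nat.cast_sub hd]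
    push_cast
    ring_nf
  · rw [indicator_of_notMem (fun h : y ∈ Ioo (0 : ℝ) r => hyr h.2),
      indicator_of_notMem (fun h => hyr (mem_Iio.1 h)), mul_zero]

/-! ## The `L^p([-π,π]^d)` norm of `‖k‖^{-a} 1_{‖k‖ < r}` -/

/-- **`‖ ‖k‖^{-a} 1_{‖k‖<r} ‖_{L^p([-π,π]^d)} ≤ (d 2^d/(d - ap))^{1/p} r^{d/p - a}`** for
`p > 0`, `ap < d`, `r > 0` (`d ≥ 1`; the norm over all of `ℝ^d` equals the right-hand side).
[cite: LiuSlade2026, proof of Lemma 3.3 (§3.2: "|k|^{-1}1_{B_L} … has L^q norm bounded by L^{1-d/q} for q^{-1} > 1/d", "‖ |k|^{-2}1_{B_L} ‖_p ≲ L^{2-d/p}, p^{-1} > 2/d")] -/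
theorem eLpNorm_norm_rpow_neg_indicator_ball_le (hd : 1 ≤ d) {a p : ℝ} (hp : 0 < p)
    (hap : a * p < d) {r : ℝ} (hr : 0 < r) :
    eLpNorm ((Metric.ball (0 : Fin d → ℝ) r).indicator fun k => ‖k‖ ^ (-a)) (ENNReal.ofReal p)
        (volume.restrict (cube d)) ≤
      ENNReal.ofReal ((d * 2 ^ d / (d - a * p)) ^ (1 / p) * r ^ ((d : ℝ) / p - a)) := by
  have hpne : ENNReal.ofReal p ≠ 0 := by simpa using hp
  have hds : 0 < (d : ℝ) - a * p := by linarith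
  set g : (Fin d → ℝ) → ℝ := (Metric.ball (0 : Fin d → ℝ) r).indicator fun k => ‖k‖ ^ (-a) with hg
  -- the integral over all of `ℝ^d`
  have hI : ∫ k in Metric.ball (0 : Fin d → ℝ) r, ‖k‖ ^ (-(a * p)) =
      d * 2 ^ d * (r ^ ((d : ℝ) - a * p) / (d - a * p)) := integral_ball_norm_rpow_neg hd hap hr
  have hI0 : 0 ≤ d * 2 ^ d * (r ^ ((d : ℝ) - a * p) / (d - a * p)) := by positivity
  have hpt : ∀ k : Fin d → ℝ, (‖g k‖ₑ : ℝ≥0∞) ^ p =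
      (Metric.ball (0 : Fin d → ℝ) r).indicator (fun k => ENNReal.ofReal (‖k‖ ^ (-(a * p)))) k := by
    intro k
    by_cases hk : k ∈ Metric.ball (0 : Fin d → ℝ) r
    · rw [hg, indicator_of_mem hk, indicator_of_mem hk, Real.enorm_eq_ofReal_abs,
        abs_of_nonneg (Real.rpow_nonneg (norm_nonneg k) _),
        ENNReal.ofReal_rpow_of_nonneg (Real.rpow_nonneg (norm_nonneg k) _) hp.le,
        ← Real.rpow_mul (norm_nonneg k), neg_mul]
    · rw [hg, indicator_of_notMem hk, indicator_of_notMem hk, enorm_zero, ENNReal.zero_rpow_of_pos hp]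
  have hlint : ∫⁻ k, (‖g k‖ₑ : ℝ≥0∞) ^ p ∂(volume.restrict (cube d)) ≤
      ENNReal.ofReal (d * 2 ^ d * (r ^ ((d : ℝ) - a * p) / (d - a * p))) := by
    calc ∫⁻ k, (‖g k‖ₑ : ℝ≥0∞) ^ p ∂(volume.restrict (cube d))
        ≤ ∫⁻ k, (‖g k‖ₑ : ℝ≥0∞) ^ p := lintegral_mono' Measure.restrict_le_self le_rfl
      _ = ∫⁻ k in Metric.ball (0 : Fin d → ℝ) r, ENNReal.ofReal (‖k‖ ^ (-(a * p))) := by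
          simp_rw [hpt]; rw [lintegral_indicator Metric.isOpen_ball.measurableSet]
      _ = ENNReal.ofReal (∫ k in Metric.ball (0 : Fin d → ℝ) r, ‖k‖ ^ (-(a * p))) :=
          (ofReal_integral_eq_lintegral_ofReal (integrableOn_ball_norm_rpow_neg hd hap hr)
            (ae_of_all _ fun k => Real.rpow_nonneg (norm_nonneg k) _)).symm
      _ = _ := by rw [hI]
  rw [eLpNorm_eq_lintegral_rpow_enorm_toReal hpne ENNReal.ofReal_ne_top, ENNReal.toReal_ofReal hp.le]
  calc (∫⁻ k, (‖g k‖ₑ : ℝ≥0∞) ^ p ∂(volume.restrict (cube d))) ^ (1 / p)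
      ≤ (ENNReal.ofReal (d * 2 ^ d * (r ^ ((d : ℝ) - a * p) / (d - a * p)))) ^ (1 / p) := by
        gcongr
    _ = ENNReal.ofReal ((d * 2 ^ d * (r ^ ((d : ℝ) - a * p) / (d - a * p))) ^ (1 / p)) :=
        ENNReal.ofReal_rpow_of_nonneg hI0 (by positivity)
    _ = ENNReal.ofReal ((d * 2 ^ d / (d - a * p)) ^ (1 / p) * r ^ ((d : ℝ) / p - a)) := by
        congr 1
        have hsplit : (d : ℝ) * 2 ^ d * (r ^ ((d : ℝ) - a * p) / (d - a * p)) =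
            (d * 2 ^ d / (d - a * p)) * r ^ ((d : ℝ) - a * p) := by ring
        rw [hsplit, Real.mul_rpow (by positivity) (Real.rpow_nonneg hr.le _), ← Real.rpow_mul hr.le]
        congr 2
        field_simp

/-- **The case `r = 1/L`**: `‖ ‖k‖^{-a} 1_{‖k‖<1/L} ‖_{L^p([-π,π]^d)} ≤ (d 2^d/(d - ap))^{1/p} L^{a - d/p}`
for `L > 0`, `p > 0`, `ap < d`. [cite: LiuSlade2026, proof of Lemma 3.3 (§3.2, the small ball B_L)] -/
theorem eLpNorm_norm_rpow_neg_indicator_ball_inv_le (hd : 1 ≤ d) {a p : ℝ} (hp : 0 < p)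
    (hap : a * p < d) {L : ℝ} (hL : 0 < L) :
    eLpNorm ((Metric.ball (0 : Fin d → ℝ) L⁻¹).indicator fun k => ‖k‖ ^ (-a)) (ENNReal.ofReal p)
        (volume.restrict (cube d)) ≤
      ENNReal.ofReal ((d * 2 ^ d / (d - a * p)) ^ (1 / p) * L ^ (a - (d : ℝ) / p)) := by
  refine (eLpNorm_norm_rpow_neg_indicator_ball_le hd hp hap (inv_pos.2 hL)).trans (le_of_eq ?_)
  rw [Real.inv_rpow hL.le, ← Real.rpow_neg hL.le, neg_sub]

end Literature.Barriers.CriticalPhenomena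

end
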